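import Mathlib
import Literature.Computability.AlgebraicComplexity.MatrixMultiplicationExponent

/- `set_option linter.dupNamespace false` as in the sibling kernel files (namespace `…Theorems.<FileStem>`). -/
set_option linter.dupNamespace false

/-!
# The slot polynomial and the polar form of a polynomial on `ℂ^N ⊗ ℂ^N ⊗ ℂ^N` (decomp-mm · lens 3 · gen 23, K2a)

Context: route `route-MatrixMultiplication-ObstructionDescent` (`ω(ℂ) = 2`), attacked leaf `E = NoPolyDegreeObstruction`
(item 30889), DEGREE axis; aside `GapOneEquationsVanish` (item 27778).  This is the first part of the POLARISATION
BRIDGE between the polynomial statement of the aside and the coefficient-tensor statement decided by the Casimir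
kernels (`ObstructionDescentCasimirCount`, `ObstructionDescentPairCasimir`).

For `f : MvPolynomial (Fin N × Fin N × Fin N) ℂ` and slots `y : Fin d → (Fin N × Fin N × Fin N → ℂ)` (a `d`-tuple of
tensors) the SLOT POLYNOMIAL is `Dpoly f y := f(Σ_k μ_k y_k) ∈ ℂ[μ_1, …, μ_d]` and the POLAR FORM is its coefficient at
`μ_1 μ_2 ⋯ μ_d` (`polarForm f y`).  Proved here, all by algebra-hom bookkeeping (no coefficient combinatorics):
* `eval_Dpoly`, `Dpoly_eq_zero_of_eval`: numeric evaluations of the slot polynomial are values of `f` at the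
  tensors `Σ_k c_k y_k`; if `f` vanishes at all of them the slot polynomial is `0` (`ℂ` is infinite);
* `tensorRank_slotSum_lt`: if every slot is a triad and two slots carry the same triad, every `Σ_k c_k y_k` has
  tensor rank `< d`;
* `Dpoly_eq_zero_of_doubled`, `polarForm_eq_zero_of_doubled` (DOUBLING VANISHING): hence, if `f` vanishes on all
  tensors of rank `< d`, the slot polynomial and the polar form vanish at every triad tuple with a repeated slot —
  the polarised form of `f ∈ I_d(σ_{d−1})` (Landsberg–Manivel 2004 Lemma 3.1; Raicu 2012 Prop. 3.4);
* `Dpoly_perm`, `polarForm_perm`: the polar form is symmetric in the slots.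
* `G3`, `G3_perm`, `G3_eq_zero_of_doubled`: the coefficient tensor in three-word form (slots = basis triads
  `e_{α_k} ⊗ e_{β_k} ⊗ e_{γ_k}`), its diagonal `S_d`-symmetry and its doubling vanishing — the object fed to
  `ObstructionDescentPairCasimir.pairExchange_eq_zero`.
Part K2b (multilinearity of the polar form, the diagonal identity) and K2c (the eight-term relation) complete the bridge.
-/

namespace Summit.MatrixMultiplication.MatrixMultiplication.Theorems.ObstructionDescentPolarForm

open MvPolynomial Finset
open Literature.Computability.AlgebraicComplexity (triad tensorRank tensorRank_le_of_eq_sum)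

/-- Coordinates of `ℂ^N ⊗ ℂ^N ⊗ ℂ^N`. [this cell] -/
abbrev Pt (N : ℕ) := Fin N × Fin N × Fin N

variable {N d : ℕ}

/-- The slot tensor `Σ_k μ_k y_k`, with entries in `ℂ[μ_1, …, μ_d]`. [this cell] -/
noncomputable def slotTensor (y : Fin d → Pt N → ℂ) : Pt N → MvPolynomial (Fin d) ℂ :=
  fun p => ∑ k, C (y k p) * X k

/-- The slot polynomial `f(Σ_k μ_k y_k) ∈ ℂ[μ_1, …, μ_d]`. [this cell] -/
noncomputable def Dpoly (f : MvPolynomial (Pt N) ℂ) (y : Fin d → Pt N → ℂ) : MvPolynomial (Fin d) ℂ :=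
  aeval (slotTensor y) f

/-- The exponent vector `(1, …, 1)` of the multilinear monomial `μ_1 ⋯ μ_d`. [this cell] -/
noncomputable def ones (d : ℕ) : Fin d →₀ ℕ := ∑ k : Fin d, Finsupp.single k 1

/-- The polar form: the coefficient of `μ_1 ⋯ μ_d` in `f(Σ_k μ_k y_k)` (for `f` homogeneous of degree `d` this is
`d!` times the classical polarisation). [this cell] -/
noncomputable def polarForm (f : MvPolynomial (Pt N) ℂ) (y : Fin d → Pt N → ℂ) : ℂ :=
  coeff (ones d) (Dpoly f y)

/-! ## Numeric evaluations -/

/-- Numeric evaluation commutes with substitution: `eval c (f(s)) = f(eval c ∘ s)`. [folklore] -/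
theorem eval_aeval_eq (s : Pt N → MvPolynomial (Fin d) ℂ) (c : Fin d → ℂ) (f : MvPolynomial (Pt N) ℂ) :
    eval c (aeval s f) = eval (fun p => eval c (s p)) f := by
  induction f using MvPolynomial.induction_on with
  | C a => simp only [aeval_C, algebraMap_eq, eval_C]
  | add p q hp hq => simp only [map_add, hp, hq]
  | mul_X p n hp => simp only [map_mul, hp, aeval_X, eval_X]

/-- Over `ℂ` as a `ℂ`-algebra, `aeval` at a point is `eval`. [folklore] -/
theorem aeval_eq_eval_pt (g : Pt N → ℂ) (f : MvPolynomial (Pt N) ℂ) : aeval g f = eval g f := by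
  induction f using MvPolynomial.induction_on with
  | C a => simp
  | add p q hp hq => rw [map_add, map_add, hp, hq]
  | mul_X p n hp => rw [map_mul, map_mul, hp, aeval_X, eval_X]

/-- Evaluating the slot polynomial at `μ = c` evaluates `f` at the tensor `Σ_k c_k y_k`. [this cell] -/
theorem eval_Dpoly (f : MvPolynomial (Pt N) ℂ) (y : Fin d → Pt N → ℂ) (c : Fin d → ℂ) :
    eval c (Dpoly f y) = eval (fun p => ∑ k, c k * y k p) f := by
  have hg : (fun p => eval c (slotTensor y p)) = fun p => ∑ k, c k * y k p := by
    funext p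
    simp only [slotTensor, map_sum, map_mul, eval_C, eval_X]
    exact Finset.sum_congr rfl fun k _ => mul_comm _ _
  unfold Dpoly
  rw [eval_aeval_eq, hg]

/-- If `f` vanishes at every tensor `Σ_k c_k y_k`, the slot polynomial is zero. [this cell] -/
theorem Dpoly_eq_zero_of_eval (f : MvPolynomial (Pt N) ℂ) (y : Fin d → Pt N → ℂ)
    (h : ∀ c : Fin d → ℂ, eval (fun p => ∑ k, c k * y k p) f = 0) : Dpoly f y = 0 := by
  apply MvPolynomial.funext
  intro c
  rw [eval_Dpoly, h, map_zero]

/-! ## Rank of a slot sum with a repeated triad -/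

/-- A sum of `d` scaled triads in which two slots carry the same triad is a sum of `d − 1` triads, so its tensor rank
is `< d`. [this cell; cite: Blaser2013, §4] -/
theorem tensorRank_slotSum_lt (y : Fin d → Pt N → ℂ)
    (hy : ∀ k, ∃ u v w : Fin N → ℂ, ∀ p : Pt N, y k p = u p.1 * v p.2.1 * w p.2.2)
    {i j : Fin d} (hij : i ≠ j) (hyij : y i = y j) (c : Fin d → ℂ) :
    tensorRank (fun a b e => ∑ k, c k * y k (a, b, e)) < d := by
  choose u v w huvw using hy
  obtain ⟨d', rfl⟩ : ∃ d', d = d' + 1 := ⟨d - 1, by have := i.isLt; omega⟩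
  obtain ⟨l₀, hl₀⟩ := Fin.exists_succAbove_eq hij
  -- merged coefficients on the slots `≠ j`
  let c' : Fin d' → ℂ := fun l => c (j.succAbove l) + if l = l₀ then c j else 0
  have key : (fun a b e => ∑ k, c k * y k (a, b, e))
      = ∑ l : Fin d', triad (fun a => c' l * u (j.succAbove l) a) (v (j.succAbove l)) (w (j.succAbove l)) := by
    funext a b e
    rw [Fin.sum_univ_succAbove _ j]
    simp only [Finset.sum_apply, triad, c']
    have hsplit : ∀ l : Fin d', (c (j.succAbove l) + if l = l₀ then c j else 0) * u (j.succAbove l) a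
        * v (j.succAbove l) b * w (j.succAbove l) e
        = c (j.succAbove l) * y (j.succAbove l) (a, b, e)
          + (if l = l₀ then c j * y j (a, b, e) else 0) := by
      intro l
      rw [huvw (j.succAbove l) (a, b, e)]
      split_ifs with h
      · subst h
        rw [hl₀, ← hyij, huvw i (a, b, e)]
        ring
      · ring
    simp_rw [hsplit]
    rw [Finset.sum_add_distrib, Finset.sum_ite_eq' univ l₀, if_pos (mem_univ _)]
    ring
  calc tensorRank (fun a b e => ∑ k, c k * y k (a, b, e)) ≤ d' := tensorRank_le_of_eq_sum _ _ _ key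
    _ < d' + 1 := Nat.lt_succ_self _

/-! ## Doubling vanishing -/

/-- DOUBLING VANISHING (slot polynomial).  If `f` vanishes on all tensors of rank `< d`, then `f(Σ_k μ_k y_k) = 0`
identically for every `d`-tuple of triads with a repeated slot. [this cell; LM04 Lemma 3.1 polarised] -/
theorem Dpoly_eq_zero_of_doubled (f : MvPolynomial (Pt N) ℂ)
    (hf : ∀ t : Fin N → Fin N → Fin N → ℂ, tensorRank t < d →
      MvPolynomial.aeval (fun p : Pt N => t p.1 p.2.1 p.2.2) f = 0)
    (y : Fin d → Pt N → ℂ) (hy : ∀ k, ∃ u v w : Fin N → ℂ, ∀ p : Pt N, y k p = u p.1 * v p.2.1 * w p.2.2)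
    {i j : Fin d} (hij : i ≠ j) (hyij : y i = y j) : Dpoly f y = 0 := by
  apply Dpoly_eq_zero_of_eval
  intro c
  have h := hf (fun a b e => ∑ k, c k * y k (a, b, e)) (tensorRank_slotSum_lt y hy hij hyij c)
  rw [aeval_eq_eval_pt] at h
  exact h

/-- DOUBLING VANISHING (polar form). [this cell; LM04 Lemma 3.1 polarised] -/
theorem polarForm_eq_zero_of_doubled (f : MvPolynomial (Pt N) ℂ)
    (hf : ∀ t : Fin N → Fin N → Fin N → ℂ, tensorRank t < d →
      MvPolynomial.aeval (fun p : Pt N => t p.1 p.2.1 p.2.2) f = 0)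
    (y : Fin d → Pt N → ℂ) (hy : ∀ k, ∃ u v w : Fin N → ℂ, ∀ p : Pt N, y k p = u p.1 * v p.2.1 * w p.2.2)
    {i j : Fin d} (hij : i ≠ j) (hyij : y i = y j) : polarForm f y = 0 := by
  rw [polarForm, Dpoly_eq_zero_of_doubled f hf y hy hij hyij, coeff_zero]

/-! ## Symmetry in the slots -/

/-- Permuting the slots renames the slot variables. [this cell] -/
theorem Dpoly_perm (f : MvPolynomial (Pt N) ℂ) (y : Fin d → Pt N → ℂ) (σ : Equiv.Perm (Fin d)) :
    Dpoly f (fun k => y (σ k)) = rename σ.symm (Dpoly f y) := by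
  have hs : slotTensor (fun k => y (σ k)) = fun p => rename σ.symm (slotTensor y p) := by
    funext p
    simp only [slotTensor, map_sum, map_mul, rename_C, rename_X]
    rw [← Equiv.sum_comp σ (fun k => C (y k p) * X (σ.symm k))]
    exact Finset.sum_congr rfl fun k _ => by rw [Equiv.symm_apply_apply]
  unfold Dpoly
  rw [hs, ← comp_aeval, AlgHom.comp_apply]

/-- The multilinear exponent is invariant under renaming by a permutation. [this cell] -/
theorem mapDomain_ones (τ : Equiv.Perm (Fin d)) : Finsupp.mapDomain τ (ones d) = ones d := by
  unfold ones
  rw [Finsupp.mapDomain_finsetSum]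
  simp only [Finsupp.mapDomain_single]
  exact Equiv.sum_comp τ (fun k => Finsupp.single k 1)

/-- The polar form is symmetric in the slots. [this cell] -/
theorem polarForm_perm (f : MvPolynomial (Pt N) ℂ) (y : Fin d → Pt N → ℂ) (σ : Equiv.Perm (Fin d)) :
    polarForm f (fun k => y (σ k)) = polarForm f y := by
  unfold polarForm
  rw [Dpoly_perm]
  have h := coeff_rename_mapDomain σ.symm σ.symm.injective (Dpoly f y) (ones d)
  rw [mapDomain_ones] at h
  exact h

/-! ## The coefficient tensor in three-word form

Slots carrying basis triads `e_{α_k} ⊗ e_{β_k} ⊗ e_{γ_k}`: this is the tensor `G` of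
`ObstructionDescentPairCasimir.pairExchange_eq_zero` (words `Fin d → Fin N` in each of the three factors). -/

/-- The basis tensor `e_a ⊗ e_b ⊗ e_c`. [this cell] -/
noncomputable def basisTensor (q : Pt N) : Pt N → ℂ := fun p => if p = q then 1 else 0

/-- A basis tensor is a triad. [this cell] -/
theorem basisTensor_triad (q : Pt N) :
    ∃ u v w : Fin N → ℂ, ∀ p : Pt N, basisTensor q p = u p.1 * v p.2.1 * w p.2.2 := by
  refine ⟨fun x => if x = q.1 then 1 else 0, fun x => if x = q.2.1 then 1 else 0,
    fun x => if x = q.2.2 then 1 else 0, fun p => ?_⟩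
  by_cases h : p = q
  · subst h; simp [basisTensor]
  · have h' : ¬(p.1 = q.1 ∧ p.2.1 = q.2.1 ∧ p.2.2 = q.2.2) := fun hh =>
      h (Prod.ext hh.1 (Prod.ext hh.2.1 hh.2.2))
    simp only [basisTensor, if_neg h, mul_ite, mul_one, mul_zero]
    split_ifs <;> simp_all

/-- The coefficient tensor of `f` in three-word form: the polar form at the basis triads
`e_{α_k} ⊗ e_{β_k} ⊗ e_{γ_k}`, `k : Fin d`. [this cell] -/
noncomputable def G3 (f : MvPolynomial (Pt N) ℂ) (α β γ : Fin d → Fin N) : ℂ :=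
  polarForm f (fun k => basisTensor (α k, β k, γ k))

/-- `G3` is invariant under simultaneous permutation of the three words (diagonal `S_d`-symmetry). [this cell] -/
theorem G3_perm (f : MvPolynomial (Pt N) ℂ) (α β γ : Fin d → Fin N) (σ : Equiv.Perm (Fin d)) :
    G3 f (α ∘ ⇑σ) (β ∘ ⇑σ) (γ ∘ ⇑σ) = G3 f α β γ :=
  polarForm_perm f (fun k => basisTensor (α k, β k, γ k)) σ

/-- DOUBLING VANISHING for `G3`: if `f` vanishes on all tensors of rank `< d` and two slots carry the same basis
triad, the coefficient vanishes. [this cell; LM04 Lemma 3.1 polarised] -/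
theorem G3_eq_zero_of_doubled (f : MvPolynomial (Pt N) ℂ)
    (hf : ∀ t : Fin N → Fin N → Fin N → ℂ, tensorRank t < d →
      MvPolynomial.aeval (fun p : Pt N => t p.1 p.2.1 p.2.2) f = 0)
    (α β γ : Fin d → Fin N) {i j : Fin d} (hij : i ≠ j)
    (h : (α i, β i, γ i) = (α j, β j, γ j)) : G3 f α β γ = 0 :=
  polarForm_eq_zero_of_doubled f hf _ (fun k => basisTensor_triad (α k, β k, γ k)) hij (by simp only [h])

end Summit.MatrixMultiplication.MatrixMultiplication.Theorems.ObstructionDescentPolarForm
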